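import Mathlib
import HarnessLib

/-!
# The Gibbs step of the entropy proof of Brégman's theorem

Radhakrishnan's entropy proof of Brégman's theorem [Radhakrishnan1997] (refined by Cuckler–Kahn
[CucklerKahn2009]) reveals a uniformly random `σ ∈ X`, `X` a finite set of permutations, row by row
and bounds the conditional entropy of the value `σ i` given the rows `B ∌ i` revealed so far.  For
the uniform measure on `X` everything is finite counting.  Write

* `N = #X`, `c j = #{σ' ∈ X : σ' i = j}` (so `j ↦ c j / N` is the law of `σ i`),
* `F σ = {σ' ∈ X : σ' = σ on B}` (the fibre of `σ` over `B`), `G σ = {σ' ∈ F σ : σ' i = σ i}`,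
* `A σ = {j : σ i' ≠ j for all i' ∈ B}` (the columns not used on `B`), `P σ = ∑_{j ∈ A σ} c j / N`.

The main result `sum_log_fibre_ratio_le_entropy_add_log_avail` is the *Gibbs step*

  `∑_{σ ∈ X} (log #F σ - log #G σ) ≤ N · ∑_j negMulLog (c j / N) + ∑_{σ ∈ X} log P σ`,

i.e. `H(σ i ∣ σ|_B) ≤ H(σ i) + 𝔼 log P σ` for uniform `σ ∈ X`: the conditional entropy of `σ i`
given `σ|_B` is at most the entropy of the law of `σ i` plus the expected logarithm of the mass of
that law still available (Gibbs' inequality against the law of `σ i` conditioned on `A σ`).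

Proof.  `N · ∑_j negMulLog (c j / N) = ∑_σ (log N - log c (σ i))` (`card_mul_sum_negMulLog_div`),
so the claim reads `∑_σ log w σ ≤ 0` for `w σ = c (σ i) · #F σ / ((N · P σ) · #G σ)`
(`sum_log_sub_log_le_of_sum_le_card`); by `log x ≤ x - 1` (`sum_log_nonpos_of_sum_le_card`) it
suffices that `∑_σ w σ ≤ N` (`sum_fibre_weights_le_card`), which is double counting: expand
`#F σ = ∑_{τ ∈ F σ} 1`, exchange the two sums, and inside a fibre `F τ` the sum
`∑_{σ ∈ F τ} c (σ i) / #G σ` collapses to `∑_{j ∈ {σ i : σ ∈ F τ}} c j ≤ N · P τ`, because the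
values `σ i`, `σ ∈ F τ`, are available columns (`sum_div_card_fiber_le_one`,
`apply_mem_filter_forall_ne`; the available mass `N · P τ ≥ c (τ i) ≥ 1` is positive,
`sum_card_filter_apply_eq_pos`).

References: J. Radhakrishnan, An entropy proof of Bregman's theorem, *J. Combin. Theory Ser. A*
77 (1997) 161–164 [Radhakrishnan1997]; B. Cuckler, J. Kahn, Entropy bounds for perfect matchings
and Hamiltonian cycles, *Combinatorica* 29 (2009) 327–335 [CucklerKahn2009].
-/

namespace Literature.Combinatorics.Enumerative

open Finset

/-! ### Elementary real lemmas -/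

/-- Gibbs' inequality through `log x ≤ x - 1`: positive weights with `∑_{b ∈ s} w b ≤ #s` satisfy
`∑_{b ∈ s} log (w b) ≤ 0`. [folklore] -/
theorem sum_log_nonpos_of_sum_le_card {β : Type*} (s : Finset β) (w : β → ℝ)
    (hw : ∀ b ∈ s, 0 < w b) (hs : ∑ b ∈ s, w b ≤ s.card) : ∑ b ∈ s, Real.log (w b) ≤ 0 := by
  calc ∑ b ∈ s, Real.log (w b) ≤ ∑ b ∈ s, (w b - 1) :=
        Finset.sum_le_sum fun b hb => Real.log_le_sub_one_of_pos (hw b hb)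
    _ = ∑ b ∈ s, w b - s.card := by
        rw [Finset.sum_sub_distrib, Finset.sum_const, nsmul_eq_mul, mul_one]
    _ ≤ 0 := by linarith

/-- Bookkeeping behind the Gibbs step: if `f, g, cc, M` are positive on `X`, `N > 0` and
`∑_{σ ∈ X} cc σ · f σ / (M σ · g σ) ≤ #X`, then
`∑_σ (log f σ - log g σ) ≤ ∑_σ (log N - log cc σ) + ∑_σ log (M σ / N)`. [folklore] -/
theorem sum_log_sub_log_le_of_sum_le_card {β : Type*} (X : Finset β) (f g cc M : β → ℝ) (N : ℝ)
    (hN : 0 < N) (hf : ∀ σ ∈ X, 0 < f σ) (hg : ∀ σ ∈ X, 0 < g σ) (hcc : ∀ σ ∈ X, 0 < cc σ)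
    (hM : ∀ σ ∈ X, 0 < M σ) (hsum : ∑ σ ∈ X, cc σ * f σ / (M σ * g σ) ≤ X.card) :
    ∑ σ ∈ X, (Real.log (f σ) - Real.log (g σ)) ≤
      ∑ σ ∈ X, (Real.log N - Real.log (cc σ)) + ∑ σ ∈ X, Real.log (M σ / N) := by
  have key : ∀ σ ∈ X, Real.log (f σ) - Real.log (g σ) = Real.log (cc σ * f σ / (M σ * g σ)) +
      ((Real.log N - Real.log (cc σ)) + Real.log (M σ / N)) := by
    intro σ hσ
    have h1 := hf σ hσ
    have h2 := hg σ hσ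
    have h3 := hcc σ hσ
    have h4 := hM σ hσ
    rw [Real.log_div (mul_pos h3 h1).ne' (mul_pos h4 h2).ne', Real.log_mul h3.ne' h1.ne',
      Real.log_mul h4.ne' h2.ne', Real.log_div h4.ne' hN.ne']
    ring
  rw [Finset.sum_congr rfl key, Finset.sum_add_distrib, Finset.sum_add_distrib]
  have hgibbs : ∑ σ ∈ X, Real.log (cc σ * f σ / (M σ * g σ)) ≤ 0 :=
    sum_log_nonpos_of_sum_le_card X (fun σ => cc σ * f σ / (M σ * g σ))
      (fun σ hσ => div_pos (mul_pos (hcc σ hσ) (hf σ hσ)) (mul_pos (hM σ hσ) (hg σ hσ))) hsum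
  linarith

/-- The entropy of the push-forward of the counting measure as a sum over points: for a finite set
`X` and a map `v`, `#X · ∑_j negMulLog (#{v = j} / #X) = ∑_{σ ∈ X} (log #X - log #{v = v σ})`.
[folklore] -/
theorem card_mul_sum_negMulLog_div {β γ : Type*} [Fintype γ] [DecidableEq γ] (X : Finset β)
    (v : β → γ) :
    (X.card : ℝ) * ∑ j, Real.negMulLog (((X.filter (fun σ => v σ = j)).card : ℝ) / (X.card : ℝ)) =
      ∑ σ ∈ X, (Real.log (X.card : ℝ) - Real.log ((X.filter (fun σ' => v σ' = v σ)).card : ℝ)) := by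
  rcases X.eq_empty_or_nonempty with rfl | hX
  · simp
  have hN : (0 : ℝ) < X.card := by exact_mod_cast hX.card_pos
  have hN' : (X.card : ℝ) ≠ 0 := hN.ne'
  have hterm : ∀ j,
      (X.card : ℝ) * Real.negMulLog (((X.filter (fun σ => v σ = j)).card : ℝ) / (X.card : ℝ)) =
        ∑ _σ ∈ X.filter (fun σ => v σ = j),
          (Real.log (X.card : ℝ) - Real.log ((X.filter (fun σ => v σ = j)).card : ℝ)) := by
    intro j
    rw [Finset.sum_const, nsmul_eq_mul]
    rcases Nat.eq_zero_or_pos (X.filter (fun σ => v σ = j)).card with h | h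
    · rw [h]
      simp
    · have hc : (0 : ℝ) < (X.filter (fun σ => v σ = j)).card := by exact_mod_cast h
      rw [Real.negMulLog, Real.log_div hc.ne' hN']
      field_simp
      ring
  rw [Finset.mul_sum, Finset.sum_congr rfl fun j _ => hterm j]
  exact Finset.sum_fiberwise' X v fun j =>
    Real.log (X.card : ℝ) - Real.log ((X.filter (fun σ => v σ = j)).card : ℝ)

/-- Collapsing a fibre sum: if `v` maps `F` into `A`, `c ≥ 0` and `M = ∑_{j ∈ A} c j > 0`, then
`∑_{σ ∈ F} c (v σ) / (M · #{σ' ∈ F : v σ' = v σ}) = ∑_{j ∈ v '' F} c j / M ≤ 1`. [folklore] -/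
theorem sum_div_card_fiber_le_one {β γ : Type*} [DecidableEq γ] (F : Finset β) (v : β → γ)
    (c : γ → ℝ) (hc : ∀ j, 0 ≤ c j) (A : Finset γ) (hA : ∀ σ ∈ F, v σ ∈ A)
    (hM : 0 < ∑ k ∈ A, c k) :
    ∑ σ ∈ F, c (v σ) / ((∑ k ∈ A, c k) * ((F.filter (fun σ' => v σ' = v σ)).card : ℝ)) ≤ 1 := by
  have hM' : (∑ k ∈ A, c k) ≠ 0 := hM.ne'
  calc ∑ σ ∈ F, c (v σ) / ((∑ k ∈ A, c k) * ((F.filter (fun σ' => v σ' = v σ)).card : ℝ))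
      = ∑ j ∈ F.image v, (F.filter (fun σ' => v σ' = j)).card •
          (c j / ((∑ k ∈ A, c k) * ((F.filter (fun σ' => v σ' = j)).card : ℝ))) :=
        Finset.sum_comp
          (fun j => c j / ((∑ k ∈ A, c k) * ((F.filter (fun σ' => v σ' = j)).card : ℝ))) v
    _ = ∑ j ∈ F.image v, c j / ∑ k ∈ A, c k := by
        refine Finset.sum_congr rfl fun j hj => ?_
        obtain ⟨σ, hσ, rfl⟩ := Finset.mem_image.mp hj
        have hpos : ((F.filter (fun σ' => v σ' = v σ)).card : ℝ) ≠ 0 := by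
          have h0 : 0 < (F.filter (fun σ' => v σ' = v σ)).card :=
            Finset.card_pos.mpr ⟨σ, Finset.mem_filter.mpr ⟨hσ, rfl⟩⟩
          exact_mod_cast h0.ne'
        rw [nsmul_eq_mul]
        field_simp
    _ ≤ ∑ j ∈ A, c j / ∑ k ∈ A, c k :=
        Finset.sum_le_sum_of_subset_of_nonneg (Finset.image_subset_iff.mpr hA)
          fun j _ _ => div_nonneg (hc j) hM.le
    _ = 1 := by rw [← Finset.sum_div, div_self hM']

/-! ### Fibres of a set of permutations over a set of revealed rows -/

section Permutations

variable {α : Type*} [Fintype α] [DecidableEq α]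

/-- If `σ` agrees with `τ` on `B` and `i ∉ B`, then the value `σ i` is a column not used by `τ` on
`B` (permutations are injective). [folklore] -/
theorem apply_mem_filter_forall_ne {i : α} {B : Finset α} (hi : i ∉ B) {σ τ : Equiv.Perm α}
    (h : ∀ i' ∈ B, σ i' = τ i') :
    σ i ∈ Finset.univ.filter (fun j => ∀ i' ∈ B, τ i' ≠ j) := by
  simp only [Finset.mem_filter, Finset.mem_univ, true_and]
  intro i' hi' heq
  rw [← h i' hi'] at heq
  exact hi (by rwa [σ.injective heq] at hi')

/-- The available mass is positive: for `τ ∈ X` the column `τ i` is not used by `τ` on `B ∌ i`, and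
`c (τ i) ≥ 1`. [folklore] -/
theorem sum_card_filter_apply_eq_pos (X : Finset (Equiv.Perm α)) (i : α) (B : Finset α)
    (hi : i ∉ B) {τ : Equiv.Perm α} (hτ : τ ∈ X) :
    (0 : ℝ) < ∑ j ∈ Finset.univ.filter (fun j => ∀ i' ∈ B, τ i' ≠ j),
      ((X.filter (fun σ' => σ' i = j)).card : ℝ) := by
  have hτi : 0 < (X.filter (fun σ' => σ' i = τ i)).card :=
    Finset.card_pos.mpr ⟨τ, Finset.mem_filter.mpr ⟨hτ, rfl⟩⟩
  have hτi' : (0 : ℝ) < ((X.filter (fun σ' => σ' i = τ i)).card : ℝ) := by exact_mod_cast hτi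
  exact lt_of_lt_of_le hτi' (Finset.single_le_sum
    (f := fun j => ((X.filter (fun σ' : Equiv.Perm α => σ' i = j)).card : ℝ))
    (fun j _ => Nat.cast_nonneg _) (apply_mem_filter_forall_ne hi fun _ _ => rfl))

/-- **The key count.**  With `c j = #{σ' ∈ X : σ' i = j}`, `F σ` and `G σ` the fibres of `σ` over
`B` and over `B ∪ {i}`, and `M σ = ∑_{j not used by σ on B} c j`:
`∑_{σ ∈ X} c (σ i) · #F σ / (M σ · #G σ) ≤ #X`.  Double counting: expand `#F σ = ∑_{τ ∈ F σ} 1`,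
exchange the two sums (agreeing on `B` is symmetric), and collapse each fibre sum with
`sum_div_card_fiber_le_one`. [folklore] -/
theorem sum_fibre_weights_le_card (X : Finset (Equiv.Perm α)) (i : α) (B : Finset α)
    (hi : i ∉ B) :
    ∑ σ ∈ X, ((X.filter (fun σ' => σ' i = σ i)).card : ℝ) *
        ((X.filter (fun σ' => ∀ i' ∈ B, σ' i' = σ i')).card : ℝ) /
        ((∑ j ∈ Finset.univ.filter (fun j => ∀ i' ∈ B, σ i' ≠ j),
            ((X.filter (fun σ' => σ' i = j)).card : ℝ)) *
          ((X.filter (fun σ' => (∀ i' ∈ B, σ' i' = σ i') ∧ σ' i = σ i)).card : ℝ)) ≤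
      (X.card : ℝ) := by
  -- expand `#F σ` as a sum of ones
  have hexp : ∀ σ ∈ X, ((X.filter (fun σ' => σ' i = σ i)).card : ℝ) *
        ((X.filter (fun σ' => ∀ i' ∈ B, σ' i' = σ i')).card : ℝ) /
        ((∑ j ∈ Finset.univ.filter (fun j => ∀ i' ∈ B, σ i' ≠ j),
            ((X.filter (fun σ' => σ' i = j)).card : ℝ)) *
          ((X.filter (fun σ' => (∀ i' ∈ B, σ' i' = σ i') ∧ σ' i = σ i)).card : ℝ)) =
      ∑ _τ ∈ X.filter (fun σ' => ∀ i' ∈ B, σ' i' = σ i'),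
        ((X.filter (fun σ' => σ' i = σ i)).card : ℝ) /
        ((∑ j ∈ Finset.univ.filter (fun j => ∀ i' ∈ B, σ i' ≠ j),
            ((X.filter (fun σ' => σ' i = j)).card : ℝ)) *
          ((X.filter (fun σ' => (∀ i' ∈ B, σ' i' = σ i') ∧ σ' i = σ i)).card : ℝ)) := by
    intro σ _
    rw [Finset.sum_const, nsmul_eq_mul]
    ring
  -- exchange the two sums
  rw [Finset.sum_congr rfl hexp, Finset.sum_comm' (t' := X)
    (s' := fun τ => X.filter (fun σ' : Equiv.Perm α => ∀ i' ∈ B, σ' i' = τ i'))]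
  · -- each fibre `F τ` contributes at most `1`
    calc _ ≤ ∑ _τ ∈ X, (1 : ℝ) := Finset.sum_le_sum fun τ hτ => ?_
      _ = X.card := by simp
    -- inside `F τ`: `M σ = M τ` and `G σ = {σ' ∈ F τ : σ' i = σ i}`
    have hcongr : ∀ σ ∈ X.filter (fun σ' => ∀ i' ∈ B, σ' i' = τ i'),
        ((X.filter (fun σ' => σ' i = σ i)).card : ℝ) /
          ((∑ j ∈ Finset.univ.filter (fun j => ∀ i' ∈ B, σ i' ≠ j),
              ((X.filter (fun σ' => σ' i = j)).card : ℝ)) *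
            ((X.filter (fun σ' => (∀ i' ∈ B, σ' i' = σ i') ∧ σ' i = σ i)).card : ℝ)) =
        ((X.filter (fun σ' => σ' i = σ i)).card : ℝ) /
          ((∑ j ∈ Finset.univ.filter (fun j => ∀ i' ∈ B, τ i' ≠ j),
              ((X.filter (fun σ' => σ' i = j)).card : ℝ)) *
            (((X.filter (fun σ' => ∀ i' ∈ B, σ' i' = τ i')).filter
              (fun σ' => σ' i = σ i)).card : ℝ)) := by
      intro σ hσ
      have hσB : ∀ i' ∈ B, σ i' = τ i' := (Finset.mem_filter.mp hσ).2
      have hA : Finset.univ.filter (fun j => ∀ i' ∈ B, σ i' ≠ j) =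
          Finset.univ.filter (fun j => ∀ i' ∈ B, τ i' ≠ j) :=
        Finset.filter_congr fun j _ => forall₂_congr fun i' hi' => by rw [hσB i' hi']
      have hG : X.filter (fun σ' => (∀ i' ∈ B, σ' i' = σ i') ∧ σ' i = σ i) =
          (X.filter (fun σ' => ∀ i' ∈ B, σ' i' = τ i')).filter (fun σ' => σ' i = σ i) := by
        rw [Finset.filter_filter]
        exact Finset.filter_congr fun σ' _ =>
          (forall₂_congr fun i' hi' => by rw [hσB i' hi']).and Iff.rfl
      rw [hA, hG]
    rw [Finset.sum_congr rfl hcongr]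
    have hc0 : ∀ j : α, (0 : ℝ) ≤ ((X.filter (fun σ' => σ' i = j)).card : ℝ) :=
      fun j => Nat.cast_nonneg _
    have hAv : ∀ σ ∈ X.filter (fun σ' => ∀ i' ∈ B, σ' i' = τ i'),
        σ i ∈ Finset.univ.filter (fun j => ∀ i' ∈ B, τ i' ≠ j) :=
      fun σ hσ => apply_mem_filter_forall_ne hi (Finset.mem_filter.mp hσ).2
    exact sum_div_card_fiber_le_one _ (fun σ : Equiv.Perm α => σ i) _ hc0 _ hAv
      (sum_card_filter_apply_eq_pos X i B hi hτ)
  · -- the exchange is legitimate: agreeing on `B` is a symmetric relation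
    intro σ τ
    simp only [Finset.mem_filter]
    constructor
    · rintro ⟨hσ, hτ, h⟩
      exact ⟨⟨hσ, fun i' hi' => (h i' hi').symm⟩, hτ⟩
    · rintro ⟨⟨hσ, h⟩, hτ⟩
      exact ⟨hσ, hτ, fun i' hi' => (h i' hi').symm⟩

/-- **The Gibbs step of the entropy proof of Brégman's theorem.**  For a nonempty finite set `X`
of permutations of a finite type, a row `i` and a set `B ∌ i` of revealed rows, with `N = #X` and
`c j = #{σ' ∈ X : σ' i = j}`:
`∑_{σ ∈ X} (log #{σ' ∈ X : σ' = σ on B} - log #{σ' ∈ X : σ' = σ on B, σ' i = σ i})`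
`  ≤ N · ∑_j negMulLog (c j / N) + ∑_{σ ∈ X} log (∑_{j : σ i' ≠ j for all i' ∈ B} c j / N)`,
i.e. `H(σ i ∣ σ|_B) ≤ H(σ i) + 𝔼 log P σ` for uniform `σ ∈ X`, where `P σ` is the mass of the law
of `σ i` on the columns not used by `σ` on `B`. [cite: Radhakrishnan1997, proof of Thm 1] -/
theorem sum_log_fibre_ratio_le_entropy_add_log_avail (X : Finset (Equiv.Perm α)) (i : α)
    (B : Finset α) (hX : X.Nonempty) (hi : i ∉ B) :
    ∑ σ ∈ X, (Real.log ((X.filter (fun σ' => ∀ i' ∈ B, σ' i' = σ i')).card : ℝ) -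
        Real.log ((X.filter (fun σ' => (∀ i' ∈ B, σ' i' = σ i') ∧ σ' i = σ i)).card : ℝ)) ≤
      (X.card : ℝ) *
          ∑ j, Real.negMulLog (((X.filter (fun σ' => σ' i = j)).card : ℝ) / (X.card : ℝ)) +
        ∑ σ ∈ X, Real.log (∑ j ∈ Finset.univ.filter (fun j => ∀ i' ∈ B, σ i' ≠ j),
          ((X.filter (fun σ' => σ' i = j)).card : ℝ) / (X.card : ℝ)) := by
  have hN : (0 : ℝ) < X.card := by exact_mod_cast hX.card_pos
  have hpos : ∀ (s : Finset (Equiv.Perm α)) (σ : Equiv.Perm α), σ ∈ s → (0 : ℝ) < s.card :=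
    fun s σ h => by exact_mod_cast Finset.card_pos.mpr ⟨σ, h⟩
  have hF : ∀ σ ∈ X, (0 : ℝ) < (X.filter (fun σ' => ∀ i' ∈ B, σ' i' = σ i')).card :=
    fun σ hσ => hpos _ σ (Finset.mem_filter.mpr ⟨hσ, fun _ _ => rfl⟩)
  have hG : ∀ σ ∈ X,
      (0 : ℝ) < (X.filter (fun σ' => (∀ i' ∈ B, σ' i' = σ i') ∧ σ' i = σ i)).card :=
    fun σ hσ => hpos _ σ (Finset.mem_filter.mpr ⟨hσ, fun _ _ => rfl, rfl⟩)
  have hC : ∀ σ ∈ X, (0 : ℝ) < (X.filter (fun σ' => σ' i = σ i)).card :=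
    fun σ hσ => hpos _ σ (Finset.mem_filter.mpr ⟨hσ, rfl⟩)
  have hM : ∀ σ ∈ X, (0 : ℝ) < ∑ j ∈ Finset.univ.filter (fun j => ∀ i' ∈ B, σ i' ≠ j),
      ((X.filter (fun σ' => σ' i = j)).card : ℝ) :=
    fun σ hσ => sum_card_filter_apply_eq_pos X i B hi hσ
  have hmain := sum_log_sub_log_le_of_sum_le_card X _ _ _ _ (X.card : ℝ) hN hF hG hC hM
    (sum_fibre_weights_le_card X i B hi)
  rw [card_mul_sum_negMulLog_div X (fun σ : Equiv.Perm α => σ i)]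
  refine hmain.trans (le_of_eq ?_)
  congr 1
  refine Finset.sum_congr rfl fun σ _ => ?_
  rw [Finset.sum_div]

end Permutations

end Literature.Combinatorics.Enumerative
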